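import Summits.ResolutionOfSingularities.ResolutionOfSingularities.Theorems.EquisingularLiftEquisingularLiftNatNDLinkedStalks
import Literature.AlgebraicGeometry.Resolution.PointBlowupHsFunMono
import Literature.AlgebraicGeometry.Resolution.StalkIdealLemmas
import HarnessLib

/-!
# [OURS · L1 W4.5(b) · EL♮(3)] ND-K5 (B4β2) SCHEME GLUE, END HALF — the reduced strict transform of the LINKED F-stage is regular over `x`

OURS · L1 W4.5(b) · EL♮(3) stmt-ResolutionOfSingularities-20148 (parent EL♮ stmt-…-20038) · counted 0 · AI-written (res-L1-w45b-iso-w2 g0, WIDTH seat on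
D-0157 DOOR 1, desk WIDTH TABLE D1′ row iso-w2 = (B4β2) `transportEnd`), weaker than expert review; nothing of [Hironaka2017] asserted; no statement of the
manuscript; resolution of singularities in positive characteristic is NOT proved here or by this.  Def-free, sorry-free, standard axioms.
`--supports stmt-ResolutionOfSingularities-20148 --as helper`.

WHAT.  Two raw-square lemmas for (B4β2) `ND.transportEnd` (SPEC v11 §13.15), complementing ✓ p644778 `ND.isRegularLocalRing_stalk_of_linked`:

* `ND.isRegularLocalRing_stalk_of_isPullback_frameBaseMap` — the A-SIDE glue with a POINTWISE hypothesis: in ONE cartesian square `b : L ⟶ A`,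
  `c : L ⟶ Spec 𝒪_{F₁,x}` over `φA : A ⟶ 𝔸ⁿ_k` and the frame base map `Xᵢ ↦ wᵢ`, a point `ℓ ∈ L` over the CLOSED point has a regular local ring as
  soon as `𝒪_{A, b ℓ}` is regular and `b ℓ` has an affine open neighbourhood `U` with `Γ(A, U)` of finite type over `k[X]` (through `φA`).  Same proof as
  p644778 (`Γ(L, b⁻¹U) ≅ Γ(A,U) ⊗_{k[X]} 𝒪_{F₁,x}`, the prime at `ℓ` lies over the origin, ring-level core ✓ p643619), reading the regularity of
  `Γ(A,U)_𝔭 = 𝒪_{A, b ℓ}` at the ONE prime `𝔭 = 𝔔 ∩ Γ(A,U)` (`comap_primeIdealOf_appLE`).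
* `ND.isRegularLocalRing_stalk_subscheme_of_linked` — the END half: with both squares of `Linked`, closed sets `T_F ⊆ F`, `T_A ⊆ A` with
  `a⁻¹ T_F = b⁻¹ T_A`, and END on the model side (the reduced structure `V(𝓙_A)` on `T_A` regular at points over the origin), the reduced structure `V(𝓙_F)` on
  `T_F` is regular at every point over `x`.  PROOF: apply the pointwise A-side glue to the PASTED square `V(𝓙_A·𝒪_L) → V(𝓙_A) → 𝔸ⁿ` (Mathlib `comapIso`,
  `IsPullback.paste_vert`; `V(𝓙_A)` is a closed subscheme, so the chart stays affine and of finite type: `Scheme.Hom.app_surjective`) to get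
  `𝒪_{L,ℓ}/(𝓙_A)_{bℓ}𝒪_{L,ℓ}` regular (tree `isRegularLocalRing_stalk_subscheme_iff`, `stalkIdeal_comap_eq_map_stalkMap`); a regular local ring is a domain,
  so that ideal is prime, hence RADICAL; `(𝓙_F·𝒪_L)_ℓ` is radical too (image of the radical `(𝓙_F)_y` under the ISOMORPHISM `𝒪_{F,y} ≅ 𝒪_{L,ℓ}` of p644778);
  both have the same radical because the two ideal sheaves have the same support `a⁻¹T_F = b⁻¹T_A` (Mathlib `vanishingIdeal_support`, tree `stalkIdeal_radical`);
  hence they are EQUAL, and `𝒪_{V(𝓙_F), z} ≅ 𝒪_{F,y}/(𝓙_F)_y ≅ 𝒪_{L,ℓ}/(𝓙_F·𝒪_L)_ℓ` is regular.  `κ(x)` arbitrary throughout.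

FEEDS.  (B4β2) `ND.transportEnd` BY NAME (file (4) `…NatNDTransportEnd` over the port `…NatNDRoundModelSplit`).
-/

set_option linter.dupNamespace false

open CategoryTheory CategoryTheory.Limits AlgebraicGeometry TopologicalSpace Topology
open MvPolynomial TensorProduct
open Literature.AlgebraicGeometry.Resolution
open AlgebraicGeometry.Scheme.IdealSheafData

namespace Summit.ResolutionOfSingularities.ResolutionOfSingularities.Cruxes.EquisingularLiftNat.Sections.ND

/-- **(B4β2) A-SIDE GLUE, POINTWISE.**  See the module docstring. [OURS · L1 W4.5b · ND-K5 (B4β2)] -/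
theorem isRegularLocalRing_stalk_of_isPullback_frameBaseMap (n : ℕ) (k : Type) [Field k] [IsAlgClosed k]
    {F₁ : Scheme.{0}} (ρ : F₁ ⟶ (Literature.AlgebraicGeometry.Motives.projectiveSpace n k).left) (x : F₁)
    [IsNoetherianRing (F₁.presheaf.stalk x)] (w : Fin n → F₁.presheaf.stalk x)
    (hw : Ideal.span (Set.range w) = IsLocalRing.maximalIdeal (F₁.presheaf.stalk x))
    (hdim : ringKrullDim (F₁.presheaf.stalk x) = n)
    {L A : Scheme.{0}} (b : L ⟶ A) (c : L ⟶ Spec (F₁.presheaf.stalk x)) (φA : A ⟶ Aff n k)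
    (sqA : IsPullback b c φA (Spec.map (CommRingCat.ofHom (MvPolynomial.eval₂Hom (baseToStalk n k ρ x) w))))
    (ℓ : L) (hℓ : c ℓ = IsLocalRing.closedPoint (F₁.presheaf.stalk x))
    (hreg : IsRegularLocalRing (A.presheaf.stalk (b ℓ)))
    (hchart : ∃ U : A.Opens, b ℓ ∈ U ∧ IsAffineOpen U ∧
      ((φA.appLE ⊤ U le_top).hom.comp (Scheme.ΓSpecIso (.of (MvPolynomial (Fin n) k))).inv.hom).FiniteType) :
    IsRegularLocalRing (L.presheaf.stalk ℓ) := by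
  classical
  -- (2) the image `z = b ℓ` lies over the origin (`c ℓ` is the closed point and `(X)·𝒪ₓ` pulls back to the origin ideal)
  have hz0 : φA (b ℓ) = affOrigin n k := by
    rw [← Scheme.Hom.comp_apply, sqA.w, Scheme.Hom.comp_apply, hℓ, Spec.map_apply]
    apply PrimeSpectrum.ext
    exact (map_originIdeal_frameChart n k F₁ ρ x w hw).2
  obtain ⟨U, hzU, hU, hUft⟩ := hchart
  -- (3) the affine open `V = b⁻¹ U` of `L` and its coordinate ring as a pushout
  have hUST : (⊤ : (Spec (F₁.presheaf.stalk x)).Opens) ≤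
      (Spec.map (CommRingCat.ofHom (MvPolynomial.eval₂Hom (baseToStalk n k ρ x) w))) ⁻¹ᵁ ⊤ := le_top
  have hUSX : U ≤ φA ⁻¹ᵁ ⊤ := le_top
  have hVdef : b ⁻¹ᵁ U ⊓ c ⁻¹ᵁ ⊤ = b ⁻¹ᵁ U ⊓ c ⁻¹ᵁ ⊤ := rfl
  have hℓV : ℓ ∈ b ⁻¹ᵁ U ⊓ c ⁻¹ᵁ ⊤ := ⟨hzU, trivial⟩
  haveI : IsAffine (⊤ : (Aff n k).Opens) := isAffineOpen_top (Aff n k)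
  haveI : IsAffine (⊤ : (Spec (F₁.presheaf.stalk x)).Opens) := isAffineOpen_top _
  haveI : IsAffine U := hU
  have hV : IsAffineOpen (b ⁻¹ᵁ U ⊓ c ⁻¹ᵁ ⊤) :=
    IsAffine.of_isIso (Scheme.Hom.isPullback_resLE sqA hUST hUSX hVdef).isoPullback.hom
  have hpo := (isIso_pushoutSection_iff sqA hUST hUSX hVdef).mp
      (isIso_pushoutSection_of_isAffineOpen sqA hUST hUSX hVdef (isAffineOpen_top _) (isAffineOpen_top _) hU)
  -- rebase the span on `R = k[X]` and `Λ = 𝒪_{F₁,x}` through `ΓSpecIso`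
  have hh_app : (Spec.map (CommRingCat.ofHom (MvPolynomial.eval₂Hom (baseToStalk n k ρ x) w))).appLE ⊤ ⊤ hUST ≫
      (Scheme.ΓSpecIso (F₁.presheaf.stalk x)).hom =
      (Scheme.ΓSpecIso (.of (MvPolynomial (Fin n) k))).hom ≫ CommRingCat.ofHom (MvPolynomial.eval₂Hom (baseToStalk n k ρ x) w) := by
    rw [Scheme.Hom.appLE]
    simp only [Opens.map_top, homOfLE_refl, op_id, CategoryTheory.Functor.map_id, Category.comp_id]
    exact Scheme.ΓSpecIso_naturality (CommRingCat.ofHom (MvPolynomial.eval₂Hom (baseToStalk n k ρ x) w))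
  have hpo' : IsPushout
      (CommRingCat.ofHom ((φA.appLE ⊤ U hUSX).hom.comp (Scheme.ΓSpecIso (.of (MvPolynomial (Fin n) k))).inv.hom))
      (CommRingCat.ofHom (MvPolynomial.eval₂Hom (baseToStalk n k ρ x) w))
      (b.appLE U (b ⁻¹ᵁ U ⊓ c ⁻¹ᵁ ⊤) (by simp))
      ((Scheme.ΓSpecIso (F₁.presheaf.stalk x)).inv ≫ c.appLE ⊤ (b ⁻¹ᵁ U ⊓ c ⁻¹ᵁ ⊤) (by simp)) := by
    refine hpo.of_iso (Scheme.ΓSpecIso (.of (MvPolynomial (Fin n) k))) (Iso.refl _) (Scheme.ΓSpecIso (F₁.presheaf.stalk x)) (Iso.refl _)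
      ?_ ?_ ?_ ?_
    · rw [Iso.refl_hom, Category.comp_id, CommRingCat.ofHom_comp, CommRingCat.ofHom_hom, CommRingCat.ofHom_hom,
        ← Category.assoc, Iso.hom_inv_id, Category.id_comp]
    · exact hh_app
    · rw [Iso.refl_hom, Iso.refl_hom, Category.comp_id, Category.id_comp]
    · rw [Iso.refl_hom, Category.comp_id, Iso.hom_inv_id_assoc]
  letI algA : Algebra (MvPolynomial (Fin n) k) Γ(A, U) :=
    ((φA.appLE ⊤ U hUSX).hom.comp (Scheme.ΓSpecIso (.of (MvPolynomial (Fin n) k))).inv.hom).toAlgebra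
  letI algΛ : Algebra (MvPolynomial (Fin n) k) (F₁.presheaf.stalk x) := (MvPolynomial.eval₂Hom (baseToStalk n k ρ x) w).toAlgebra
  have hpoT := CommRingCat.isPushout_tensorProduct (MvPolynomial (Fin n) k) Γ(A, U) (F₁.presheaf.stalk x)
  rw [show CommRingCat.ofHom (algebraMap (MvPolynomial (Fin n) k) Γ(A, U)) =
      CommRingCat.ofHom ((φA.appLE ⊤ U hUSX).hom.comp (Scheme.ΓSpecIso (.of (MvPolynomial (Fin n) k))).inv.hom) from rfl,
    show CommRingCat.ofHom (algebraMap (MvPolynomial (Fin n) k) (F₁.presheaf.stalk x)) =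
      CommRingCat.ofHom (MvPolynomial.eval₂Hom (baseToStalk n k ρ x) w) from rfl] at hpoT
  let eP : CommRingCat.of (Γ(A, U) ⊗[MvPolynomial (Fin n) k] (F₁.presheaf.stalk x)) ≅ Γ(L, b ⁻¹ᵁ U ⊓ c ⁻¹ᵁ ⊤) :=
    hpoT.isoIsPushout _ _ hpo'
  have heP_inl : CommRingCat.ofHom (Algebra.TensorProduct.includeLeftRingHom :
      Γ(A, U) →+* Γ(A, U) ⊗[MvPolynomial (Fin n) k] (F₁.presheaf.stalk x)) ≫ eP.hom = b.appLE U (b ⁻¹ᵁ U ⊓ c ⁻¹ᵁ ⊤) (by simp) :=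
    hpoT.inl_isoIsPushout_hom _ _ hpo'
  let e : Γ(A, U) ⊗[MvPolynomial (Fin n) k] (F₁.presheaf.stalk x) ≃+* (Γ(L, b ⁻¹ᵁ U ⊓ c ⁻¹ᵁ ⊤) : Type) :=
    eP.commRingCatIsoToRingEquiv
  have he : (e : Γ(A, U) ⊗[MvPolynomial (Fin n) k] (F₁.presheaf.stalk x) →+* (Γ(L, b ⁻¹ᵁ U ⊓ c ⁻¹ᵁ ⊤) : Type)) = eP.hom.hom := rfl
  -- (4) the prime `𝔔` of `Γ(L, V)` at `ℓ`, and its transport `𝔔'` to `Γ(A,U) ⊗ 𝒪ₓ`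
  haveI hQp : (hV.primeIdealOf ⟨ℓ, hℓV⟩).asIdeal.IsPrime := (hV.primeIdealOf ⟨ℓ, hℓV⟩).isPrime
  haveI hQ'p : ((hV.primeIdealOf ⟨ℓ, hℓV⟩).asIdeal.comap e).IsPrime := Ideal.IsPrime.comap _
  -- `𝔔'` lies over the origin
  have hcompR : (e : Γ(A, U) ⊗[MvPolynomial (Fin n) k] (F₁.presheaf.stalk x) →+* (Γ(L, b ⁻¹ᵁ U ⊓ c ⁻¹ᵁ ⊤) : Type)).comp
      (algebraMap (MvPolynomial (Fin n) k) (Γ(A, U) ⊗[MvPolynomial (Fin n) k] (F₁.presheaf.stalk x))) =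
      ((b ≫ φA).appLE ⊤ (b ⁻¹ᵁ U ⊓ c ⁻¹ᵁ ⊤) le_top).hom.comp (Scheme.ΓSpecIso (.of (MvPolynomial (Fin n) k))).inv.hom := by
    have h1 : algebraMap (MvPolynomial (Fin n) k) (Γ(A, U) ⊗[MvPolynomial (Fin n) k] (F₁.presheaf.stalk x)) =
        (Algebra.TensorProduct.includeLeftRingHom : Γ(A, U) →+* Γ(A, U) ⊗[MvPolynomial (Fin n) k] (F₁.presheaf.stalk x)).comp
          ((φA.appLE ⊤ U hUSX).hom.comp (Scheme.ΓSpecIso (.of (MvPolynomial (Fin n) k))).inv.hom) := by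
      ext r <;> simp [Algebra.TensorProduct.algebraMap_apply, RingHom.algebraMap_toAlgebra]
    have h2 : eP.hom.hom.comp (Algebra.TensorProduct.includeLeftRingHom :
        Γ(A, U) →+* Γ(A, U) ⊗[MvPolynomial (Fin n) k] (F₁.presheaf.stalk x)) = (b.appLE U (b ⁻¹ᵁ U ⊓ c ⁻¹ᵁ ⊤) (by simp)).hom := by
      rw [← heP_inl]
      rfl
    rw [h1, ← RingHom.comp_assoc, he, h2, ← RingHom.comp_assoc]
    congr 1
    rw [← CommRingCat.hom_comp, Scheme.Hom.appLE_comp_appLE]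
  have hQ' : ((hV.primeIdealOf ⟨ℓ, hℓV⟩).asIdeal.comap e).under (MvPolynomial (Fin n) k) =
      Literature.AlgebraicGeometry.Resolution.originIdeal k n := by
    rw [Ideal.under_def, show Ideal.comap e (hV.primeIdealOf ⟨ℓ, hℓV⟩).asIdeal =
        Ideal.comap (e : Γ(A, U) ⊗[MvPolynomial (Fin n) k] (F₁.presheaf.stalk x) →+* (Γ(L, b ⁻¹ᵁ U ⊓ c ⁻¹ᵁ ⊤) : Type))
          (hV.primeIdealOf ⟨ℓ, hℓV⟩).asIdeal from rfl,
      Ideal.comap_comap, hcompR, ← Ideal.comap_comap]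
    have h1 : (hV.primeIdealOf ⟨ℓ, hℓV⟩).asIdeal.comap ((b ≫ φA).appLE ⊤ (b ⁻¹ᵁ U ⊓ c ⁻¹ᵁ ⊤) le_top).hom =
        ((isAffineOpen_top (Aff n k)).primeIdealOf ⟨(b ≫ φA) ℓ, trivial⟩).asIdeal :=
      congrArg PrimeSpectrum.asIdeal (IsAffineOpen.comap_primeIdealOf_appLE ⊤ (isAffineOpen_top _) _ hV le_top hℓV)
    rw [h1]
    -- the prime of `Γ(𝔸ⁿ, ⊤)` at a point `p`, pulled back along `ΓSpecIso⁻¹`, is `p`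
    have h2 : ∀ p : Aff n k, (((isAffineOpen_top (Aff n k)).primeIdealOf ⟨p, trivial⟩).asIdeal).comap
        (Scheme.ΓSpecIso (.of (MvPolynomial (Fin n) k))).inv.hom = p.asIdeal := by
      intro p
      rw [IsAffineOpen.primeIdealOf_eq_map_closedPoint, Spec.map_apply, PrimeSpectrum.comap_asIdeal, Ideal.comap_comap,
        ← CommRingCat.hom_comp]
      have h3 : (Scheme.ΓSpecIso (.of (MvPolynomial (Fin n) k))).inv ≫ (Aff n k).presheaf.germ ⊤ p trivial =
          StructureSheaf.toStalk (MvPolynomial (Fin n) k) p := by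
        rw [Scheme.ΓSpecIso_inv]; rfl
      rw [h3]
      letI := StructureSheaf.stalkAlgebra (MvPolynomial (Fin n) k) p
      haveI : IsLocalization.AtPrime ((Spec.structureSheaf (MvPolynomial (Fin n) k)).presheaf.stalk p) p.asIdeal :=
        StructureSheaf.IsLocalization.to_stalk (MvPolynomial (Fin n) k) p
      exact IsLocalization.AtPrime.under_maximalIdeal ((Spec.structureSheaf (MvPolynomial (Fin n) k)).presheaf.stalk p) p.asIdeal
    rw [h2, Scheme.Hom.comp_apply, hz0]
    rfl
  -- (5) hypotheses of the ring-level core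
  haveI : Module.Flat (MvPolynomial (Fin n) k) (F₁.presheaf.stalk x) := flat_frameChart n k F₁ ρ x w hw hdim
  have hΛmax : (Ideal.map (algebraMap (MvPolynomial (Fin n) k) (F₁.presheaf.stalk x))
      (Literature.AlgebraicGeometry.Resolution.originIdeal k n)).IsMaximal := by
    rw [RingHom.algebraMap_toAlgebra, (map_originIdeal_frameChart n k F₁ ρ x w hw).1]
    exact IsLocalRing.maximalIdeal.isMaximal _
  haveI : Algebra.FiniteType (MvPolynomial (Fin n) k) Γ(A, U) := hUft
  haveI : IsNoetherianRing Γ(A, U) := Algebra.FiniteType.isNoetherianRing (MvPolynomial (Fin n) k) Γ(A, U)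
  haveI : Algebra.EssFiniteType (MvPolynomial (Fin n) k) Γ(A, U) := inferInstance
  haveI : IsNoetherianRing (Γ(A, U) ⊗[MvPolynomial (Fin n) k] (F₁.presheaf.stalk x)) := by
    haveI : Algebra.FiniteType (F₁.presheaf.stalk x) ((F₁.presheaf.stalk x) ⊗[MvPolynomial (Fin n) k] Γ(A, U)) := inferInstance
    haveI : IsNoetherianRing ((F₁.presheaf.stalk x) ⊗[MvPolynomial (Fin n) k] Γ(A, U)) :=
      Algebra.FiniteType.isNoetherianRing (F₁.presheaf.stalk x) _
    exact isNoetherianRing_of_ringEquiv ((F₁.presheaf.stalk x) ⊗[MvPolynomial (Fin n) k] Γ(A, U))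
      (Algebra.TensorProduct.comm (MvPolynomial (Fin n) k) (F₁.presheaf.stalk x) Γ(A, U)).toRingEquiv
  -- (6) the core: `(Γ(A,U) ⊗ 𝒪ₓ)_𝔔'` is regular since `Γ(A,U)_{𝔔' ∩ Γ(A,U)} = 𝒪_{A, b ℓ}` is
  have hunder : ((hV.primeIdealOf ⟨ℓ, hℓV⟩).asIdeal.comap e).under Γ(A, U) = (hU.primeIdealOf ⟨b ℓ, hzU⟩).asIdeal := by
    rw [Ideal.under_def, show Ideal.comap e (hV.primeIdealOf ⟨ℓ, hℓV⟩).asIdeal =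
        Ideal.comap (e : Γ(A, U) ⊗[MvPolynomial (Fin n) k] (F₁.presheaf.stalk x) →+* (Γ(L, b ⁻¹ᵁ U ⊓ c ⁻¹ᵁ ⊤) : Type))
          (hV.primeIdealOf ⟨ℓ, hℓV⟩).asIdeal from rfl, Ideal.comap_comap]
    have h1 : (e : Γ(A, U) ⊗[MvPolynomial (Fin n) k] (F₁.presheaf.stalk x) →+* (Γ(L, b ⁻¹ᵁ U ⊓ c ⁻¹ᵁ ⊤) : Type)).comp
        (algebraMap Γ(A, U) (Γ(A, U) ⊗[MvPolynomial (Fin n) k] (F₁.presheaf.stalk x))) = (b.appLE U (b ⁻¹ᵁ U ⊓ c ⁻¹ᵁ ⊤) (by simp)).hom := by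
      rw [he, ← heP_inl]
      rfl
    rw [h1]
    exact congrArg PrimeSpectrum.asIdeal (IsAffineOpen.comap_primeIdealOf_appLE U hU _ hV (by simp) hℓV)
  have hregp : IsRegularLocalRing (Localization.AtPrime (((hV.primeIdealOf ⟨ℓ, hℓV⟩).asIdeal.comap e).under Γ(A, U))) := by
    have hM : (((hV.primeIdealOf ⟨ℓ, hℓV⟩).asIdeal.comap e).under Γ(A, U)).primeCompl = (hU.primeIdealOf ⟨b ℓ, hzU⟩).asIdeal.primeCompl := by
      ext y
      change y ∉ _ ↔ y ∉ _
      rw [hunder]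
    haveI : IsLocalization.AtPrime (Localization.AtPrime (((hV.primeIdealOf ⟨ℓ, hℓV⟩).asIdeal.comap e).under Γ(A, U)))
        (hU.primeIdealOf ⟨b ℓ, hzU⟩).asIdeal := by
      change IsLocalization (hU.primeIdealOf ⟨b ℓ, hzU⟩).asIdeal.primeCompl _
      rw [← hM]
      exact Localization.isLocalization
    letI := TopCat.Presheaf.algebra_section_stalk A.presheaf (⟨b ℓ, hzU⟩ : U)
    haveI : IsLocalization.AtPrime (A.presheaf.stalk (b ℓ)) (hU.primeIdealOf ⟨b ℓ, hzU⟩).asIdeal := hU.isLocalization_stalk ⟨b ℓ, hzU⟩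
    exact IsRegularLocalRing.of_ringEquiv
      (IsLocalization.algEquiv (hU.primeIdealOf ⟨b ℓ, hzU⟩).asIdeal.primeCompl (A.presheaf.stalk (b ℓ))
        (Localization.AtPrime (((hV.primeIdealOf ⟨ℓ, hℓV⟩).asIdeal.comap e).under Γ(A, U)))).toRingEquiv
  have hreg' : IsRegularLocalRing (Localization.AtPrime ((hV.primeIdealOf ⟨ℓ, hℓV⟩).asIdeal.comap e)) :=
    (isRegularLocalRing_localization_tensor_iff_of_under_eq_originIdeal k n hΛmax _ hQ').mpr hregp
  -- (7) transport: `(Γ(A,U) ⊗ 𝒪ₓ)_𝔔' ≅ Γ(L,V)_𝔔 ≅ 𝒪_{L,ℓ}`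
  haveI : IsRegularLocalRing (Localization.AtPrime (hV.primeIdealOf ⟨ℓ, hℓV⟩).asIdeal) :=
    IsRegularLocalRing.of_ringEquiv
      (IsLocalization.ringEquivOfRingEquiv (Localization.AtPrime ((hV.primeIdealOf ⟨ℓ, hℓV⟩).asIdeal.comap e))
        (Localization.AtPrime (hV.primeIdealOf ⟨ℓ, hℓV⟩).asIdeal) e (e.map_primeCompl_comap_eq (hV.primeIdealOf ⟨ℓ, hℓV⟩).asIdeal))
  letI := TopCat.Presheaf.algebra_section_stalk L.presheaf (⟨ℓ, hℓV⟩ : (b ⁻¹ᵁ U ⊓ c ⁻¹ᵁ ⊤ : L.Opens))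
  haveI : IsLocalization.AtPrime (L.presheaf.stalk ℓ) (hV.primeIdealOf ⟨ℓ, hℓV⟩).asIdeal := hV.isLocalization_stalk ⟨ℓ, hℓV⟩
  exact IsRegularLocalRing.of_ringEquiv
    (IsLocalization.algEquiv (hV.primeIdealOf ⟨ℓ, hℓV⟩).asIdeal.primeCompl
      (Localization.AtPrime (hV.primeIdealOf ⟨ℓ, hℓV⟩).asIdeal) (L.presheaf.stalk ℓ)).toRingEquiv

/-- **(B4β2) SCHEME GLUE, END HALF.**  See the module docstring; stated for arbitrary ideal sheaves `𝓙_F` (radical) on `F` and `𝓙_A` on `A` whose supports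
correspond under the link (`a⁻¹ V(𝓙_F) = b⁻¹ V(𝓙_A)`); (B4β2) uses the reduced structures on the closed sets `T_F`, `T_A`. [OURS · L1 W4.5b · ND-K5 (B4β2)] -/
theorem isRegularLocalRing_stalk_subscheme_of_linked (n : ℕ) (k : Type) [Field k] [IsAlgClosed k]
    {F₁ : Scheme.{0}} (ρ : F₁ ⟶ (Literature.AlgebraicGeometry.Motives.projectiveSpace n k).left) (x : F₁)
    [IsNoetherianRing (F₁.presheaf.stalk x)] (w : Fin n → F₁.presheaf.stalk x)
    (hw : Ideal.span (Set.range w) = IsLocalRing.maximalIdeal (F₁.presheaf.stalk x))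
    (hdim : ringKrullDim (F₁.presheaf.stalk x) = n)
    {L F A : Scheme.{0}} (a : L ⟶ F) (b : L ⟶ A) (c : L ⟶ Spec (F₁.presheaf.stalk x)) (φF : F ⟶ F₁) (φA : A ⟶ Aff n k)
    (sqF : IsPullback a c φF (F₁.fromSpecStalk x))
    (sqA : IsPullback b c φA (Spec.map (CommRingCat.ofHom (MvPolynomial.eval₂Hom (baseToStalk n k ρ x) w))))
    (JF : F.IdealSheafData) (JA : A.IdealSheafData) (hJFrad : JF.radical = JF)
    (hT : a ⁻¹' (JF.support : Set F) = b ⁻¹' (JA.support : Set A))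
    (hchart : ∀ z : A, φA z = affOrigin n k → ∃ U : A.Opens, z ∈ U ∧ IsAffineOpen U ∧
      ((φA.appLE ⊤ U le_top).hom.comp (Scheme.ΓSpecIso (.of (MvPolynomial (Fin n) k))).inv.hom).FiniteType)
    (hend : ∀ z : ↥JA.subscheme, (JA.subschemeι z : A) ∈ φA ⁻¹' {affOrigin n k} → IsRegularLocalRing (JA.subscheme.presheaf.stalk z))
    (z : ↥JF.subscheme) (hz : φF (JF.subschemeι z) = x) :
    IsRegularLocalRing (JF.subscheme.presheaf.stalk z) := by
  classical
  rw [isRegularLocalRing_stalk_subscheme_iff JF z]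
  -- (1) the point `y = ι z` over `x`, its lift `ℓ ∈ L` over the closed point, and the stalk isomorphism `𝒪_{F,y} ≅ 𝒪_{L,ℓ}`
  have hyT : (JF.subschemeι.base z : F) ∈ (JF.support : Set F) := by
    rw [← Scheme.IdealSheafData.range_subschemeι]; exact ⟨z, rfl⟩
  obtain ⟨ℓ, hℓy, hℓ⟩ := exists_preimage_of_isPullback_fromSpecStalk x sqF (JF.subschemeι.base z) hz
  haveI := isIso_stalkMap_of_isPullback_fromSpecStalk x sqF ℓ
  let ea : F.presheaf.stalk (a ℓ) ≃+* L.presheaf.stalk ℓ := (asIso (a.stalkMap ℓ)).commRingCatIsoToRingEquiv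
  have hea : (ea : F.presheaf.stalk (a ℓ) →+* L.presheaf.stalk ℓ) = (a.stalkMap ℓ).hom := rfl
  -- the ideal `(𝓙_F · 𝒪_L)_ℓ` is the image of `(𝓙_F)_y`
  have hPF : stalkIdeal (JF.comap a) ℓ = (stalkIdeal JF (a ℓ)).map (ea : F.presheaf.stalk (a ℓ) →+* L.presheaf.stalk ℓ) := by
    rw [hea]; exact stalkIdeal_comap_eq_map_stalkMap a JF ℓ
  -- (2) `ℓ` lies on `V(𝓙_A · 𝒪_L)`
  have hℓT : ℓ ∈ ((JA.comap b).support : Set L) := by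
    rw [Scheme.IdealSheafData.support_comap]
    change b ℓ ∈ (JA.support : Set A)
    have : ℓ ∈ a ⁻¹' (JF.support : Set F) := by rw [Set.mem_preimage, hℓy]; exact hyT
    rwa [hT] at this
  obtain ⟨ℓ', hℓ'⟩ : ∃ ℓ' : ↥(JA.comap b).subscheme, (JA.comap b).subschemeι ℓ' = ℓ := by
    have : ℓ ∈ Set.range (JA.comap b).subschemeι := by rw [Scheme.IdealSheafData.range_subschemeι]; exact hℓT
    exact this
  -- (3) the pasted square `V(𝓙_A · 𝒪_L) → V(𝓙_A) → 𝔸ⁿ` and the A-side glue at `ℓ'`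
  have sq1 : IsPullback (JA.comap b).subschemeι
      (Scheme.IdealSheafData.subschemeMap _ _ b (JA.le_map_comap b)) b JA.subschemeι :=
    IsPullback.of_iso_pullback ⟨by simp⟩ (JA.comapIso b) (JA.comapIso_hom_fst b) (JA.comapIso_hom_snd b)
  have sqA' : IsPullback (Scheme.IdealSheafData.subschemeMap _ _ b (JA.le_map_comap b)) ((JA.comap b).subschemeι ≫ c)
      (JA.subschemeι ≫ φA) (Spec.map (CommRingCat.ofHom (MvPolynomial.eval₂Hom (baseToStalk n k ρ x) w))) :=
    sq1.flip.paste_vert sqA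
  have hbℓ' : JA.subschemeι (Scheme.IdealSheafData.subschemeMap _ _ b (JA.le_map_comap b) ℓ') = b ℓ := by
    rw [← Scheme.Hom.comp_apply, Scheme.IdealSheafData.subschemeMap_subschemeι, Scheme.Hom.comp_apply]
    exact congrArg b hℓ'
  have hz0 : φA (b ℓ) = affOrigin n k := by
    rw [← Scheme.Hom.comp_apply, sqA.w, Scheme.Hom.comp_apply, hℓ, Spec.map_apply]
    apply PrimeSpectrum.ext
    exact (map_originIdeal_frameChart n k F₁ ρ x w hw).2
  have hregL' : IsRegularLocalRing ((JA.comap b).subscheme.presheaf.stalk ℓ') := by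
    refine isRegularLocalRing_stalk_of_isPullback_frameBaseMap n k ρ x w hw hdim
      (Scheme.IdealSheafData.subschemeMap _ _ b (JA.le_map_comap b)) ((JA.comap b).subschemeι ≫ c) (JA.subschemeι ≫ φA) sqA' ℓ'
      (by rw [Scheme.Hom.comp_apply, hℓ', hℓ]) ?_ ?_
    · exact hend _ (by rw [Set.mem_preimage, hbℓ']; exact hz0)
    · obtain ⟨U, hzU, hU, hUft⟩ := hchart (b ℓ) hz0
      refine ⟨JA.subschemeι ⁻¹ᵁ U, by change JA.subschemeι _ ∈ U; rw [hbℓ']; exact hzU, hU.preimage _, ?_⟩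
      have happ : ((JA.subschemeι ≫ φA).appLE ⊤ (JA.subschemeι ⁻¹ᵁ U) le_top).hom =
          (JA.subschemeι.app U).hom.comp (φA.appLE ⊤ U le_top).hom := by
        rw [← CommRingCat.hom_comp, Scheme.Hom.app_eq_appLE, Scheme.Hom.appLE_comp_appLE]
      rw [happ, RingHom.comp_assoc]
      exact hUft.comp_surjective (JA.subschemeι.app_surjective U hU)
  -- hence `𝒪_{L,ℓ} / (𝓙_A · 𝒪_L)_ℓ` is regular, and that ideal is prime, hence radical
  haveI hregQA : IsRegularLocalRing (L.presheaf.stalk ℓ ⧸ stalkIdeal (JA.comap b) ℓ) := by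
    have := (isRegularLocalRing_stalk_subscheme_iff (JA.comap b) ℓ').mp hregL'
    rwa [hℓ'] at this
  have hPArad : (stalkIdeal (JA.comap b) ℓ).IsRadical := by
    haveI : IsDomain (L.presheaf.stalk ℓ ⧸ stalkIdeal (JA.comap b) ℓ) := isDomain_of_isRegularLocalRing _
    exact ((Ideal.Quotient.isDomain_iff_prime _).mp inferInstance).isRadical
  -- (4) `(𝓙_F · 𝒪_L)_ℓ` is radical (image of a radical ideal under an isomorphism)
  have hPFrad : (stalkIdeal (JF.comap a) ℓ).IsRadical := by
    rw [hPF, Ideal.map_comap_of_equiv]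
    refine Ideal.IsRadical.comap _ ?_
    rw [← Ideal.radical_eq_iff, ← stalkIdeal_radical, hJFrad]
  -- (5) the two ideals have the same radical (same support), hence are equal
  have hsupp : (JF.comap a).support = (JA.comap b).support := by
    apply TopologicalSpace.Closeds.ext
    rw [Scheme.IdealSheafData.support_comap, Scheme.IdealSheafData.support_comap, TopologicalSpace.Closeds.coe_preimage,
      TopologicalSpace.Closeds.coe_preimage]
    exact hT
  have hradeq : (stalkIdeal (JF.comap a) ℓ).radical = (stalkIdeal (JA.comap b) ℓ).radical := by
    rw [← stalkIdeal_radical, ← stalkIdeal_radical, ← Scheme.IdealSheafData.vanishingIdeal_support,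
      ← Scheme.IdealSheafData.vanishingIdeal_support, hsupp]
  have heq : stalkIdeal (JF.comap a) ℓ = stalkIdeal (JA.comap b) ℓ := by
    rw [← hPFrad.radical, ← hPArad.radical, hradeq]
  -- (6) conclude through `𝒪_{F,y}/(𝓙_F)_y ≅ 𝒪_{L,ℓ}/(𝓙_F · 𝒪_L)_ℓ`
  have hy' : (JF.subschemeι.base z : F) = a ℓ := hℓy.symm
  rw [hy']
  have eq : (F.presheaf.stalk (a ℓ) ⧸ stalkIdeal JF (a ℓ)) ≃+* (L.presheaf.stalk ℓ ⧸ stalkIdeal (JA.comap b) ℓ) :=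
    Ideal.quotientEquiv _ _ ea (by rw [← heq, hPF])
  exact IsRegularLocalRing.of_ringEquiv eq.symm

end Summit.ResolutionOfSingularities.ResolutionOfSingularities.Cruxes.EquisingularLiftNat.Sections.ND
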